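import Summits.ValiantsHypothesis.ValiantsHypothesis.Theorems.GrenetZeonGlynnPoint
import HarnessLib

/-!
# Route GrenetZeon — the item `ZeonPoint` (stmt-ValiantsHypothesis-8066)

The item asks, for every `n`, for a commutative ℂ-algebra `R` with `dim_ℂ R ≤ 2^n`, a functional
`l : R → ℂ` and an `n × n` matrix of linear forms over `R` with `per_n = l(det)` coefficientwise
(the route's "zeon point" `(n, 2^n)` on the Grenet–zeon line). As FILED the item is implied by the
Glynn point `(n, 2^{n-1})` (`GrenetZeonGlynnPoint.lean`, `glynnPoint_proof`: the semisimple algebra of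
functions on the half cube `{±1}^{n-1}`), since `2^{n-1} ≤ 2^n`; for `n = 0` take `R = ℂ` and the
empty matrix (`det = 1 = per_0`). The zeon-algebra witness `ℂ[z]/(z_i²)` suggested in the item text
(and attached to the item as a grounder's candidate file, not readable from this seat) is therefore
not needed for the signature; nothing is claimed about it here.

Honest framing: route bookkeeping with a classical identity (Glynn 2010); no lower bound, and nothing
here is progress on VP ≠ VNP.
-/

set_option linter.dupNamespace false

noncomputable section

namespace Summit.ValiantsHypothesis.ValiantsHypothesis.Theorems.GrenetZeonGlynn

open Summit.ValiantsHypothesis.ValiantsHypothesis.Theses.GrenetZeon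

/-- **Item `ZeonPoint` (stmt-ValiantsHypothesis-8066), PROVED** from the Glynn point: for `n ≥ 1` the
witness of `glynnPoint_proof` has `dim R = 2^{n-1} ≤ 2^n`; for `n = 0`, `R = ℂ`, `l = id` and the
empty matrix. [cite: Glynn2010, Thm. 2.1] -/
theorem zeonPoint_proof : ZeonPoint := by
  intro n
  rcases Nat.eq_zero_or_pos n with rfl | hn
  · refine ⟨ℂ, inferInstance, inferInstance, inferInstance, ?_, LinearMap.id, Matrix.of fun _ _ => 0,
      fun i _ => Fin.elim0 i, fun d => ?_⟩
    · rw [Module.finrank_self]; exact le_of_eq (pow_zero 2).symm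
    · rw [Matrix.det_isEmpty, LinearMap.id_apply, Literature.Computability.AlgebraicComplexity.perPoly,
        Matrix.permanent_eq_one_of_card_eq_zero (Fintype.card_fin 0)]
  · obtain ⟨R, i₁, i₂, i₃, hrank, l, A, hA, hcoeff⟩ := glynnPoint_proof n hn
    exact ⟨R, i₁, i₂, i₃, hrank.trans (Nat.pow_le_pow_right (by norm_num) (Nat.sub_le n 1)), l, A, hA,
      hcoeff⟩

end Summit.ValiantsHypothesis.ValiantsHypothesis.Theorems.GrenetZeonGlynn

end
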